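import Literature.IUT.HodgeArakelov.Rmk111SchemaClosures
import HarnessLib

/-!
# [IUTchII] Rmk. 1.1.1 (iii), last sentence — FACT-LIST F-0672 `rigidity_is_difference`: the direct-head
# (conclusion = the frozen predicate) instance forms (proof-only)

Mochizuki, *Inter-universal Teichmüller theory II*, §1, Remark 1.1.1 (iii), kurims manuscript (Dec. 2020)
p. 23 l. 3–6 [claim: Mochizuki2012, status: disputed] (IUTchII §1 Rmk 1.1.1 (iii), kurims p.23): «The
mono-theta-theoretic cyclotomic rigidity isomorphism of Definition 1.1, (ii), is then reconstructed
[cf. [EtTh], Corollary 2.19, (i)] by forming the difference of the two sections `s^Θ(M^Θ)|_{(l·Δ_Θ)}`,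
`s^alg(M^Θ)|_{(l·Δ_Θ)}`».  abc-iut-L6-t1 typed the sentence as the predicate `rigidity_is_difference Sec C`
(`MonoThetaSymmetries.lean`, FROZEN): for lifts `t ∈ s^Θ`, `s ∈ s^alg` over `a`, `C.iso[a mod N] = t · s⁻¹`
in `Π_M|_{(l·Δ_Θ)(M)}`.

PROOF-ONLY companion (abc-iut cell, block F, KEY row INST59D, seat abc-iut-f-055; 0 `def` / `structure` /
`instance`, no `Prop` fact, no FACT-LIST row consumed).  State of the row in the tree: the universal closure
is REFUTED at a GENUINE two-sections datum (`not_forall_rigidity_is_difference`, abc-iut-f-127,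
`Rmk111SchemaClosures.lean`: B8's datum with `N = 3`); the predicate HOLDS for the difference-convention datum
`C′` of the [EtTh] model frame (`ModelFrame.exists_twoSections_rigidity_of_coreTower`, abc-iut-w4-d043) — but
that theorem is an `∃`-statement whose witnesses `T`, `Sec`, `C′` are constructions internal to its proof, so
the L-F kernel census (plan/LF-KERNEL-STATUS.tsv, 2026-08-27, col 14: «∃/∧-witnesses 5 · iff 1») found NO
theorem whose conclusion head is `rigidity_is_difference`.  A CLOSED direct-head form at the genuine datum
would require NAMING those witnesses (new definitions — barred in a proof-only file and not this row's
content).  What this file supplies, each labelled for what it is: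

* `rigidity_is_difference_of_iso_eq` / `rigidity_is_difference_iff_of_iso_eq` — TRANSPORT: the predicate
  depends on the Def. 1.1 (ii) datum only through its isomorphism `C.iso`; together with abc-iut-f-127's
  `CyclotomicRigidity.iso_eq_of_rigidity_is_difference` («(iii) PINS the datum») this says that, for a fixed
  two-sections datum, the data satisfying the predicate are EXACTLY those with one isomorphism;
* `rigidity_is_difference_of_forall_mul_self_eq_one` — CONDITIONAL direct-head form at ANY datum `C` whose
  isomorphism is the pointwise INVERSE of one satisfying the predicate (the situation of B8's named datum
  `ModelFrame.cyclotomicRigidity` versus `C′`, abc-iut-w5-d225's convention record): `C` satisfies the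
  predicate as soon as `Π_μ(M)` is `2`-torsion — the backward half of abc-iut-f-127's
  `rigidity_is_difference_iff_forall_mul_self_eq_one`, the only case the closure refuter spares for B8's
  convention;
* `rigidity_is_difference_of_inv_of_forall_mul_self_eq_one` — the same with the roles of `C`, `C′` swapped
  (inversion is an involution), so that the `2`-torsion clause makes the two conventions interchangeable.

HONEST LABEL: all forms here are CONDITIONAL / transport; print fixes no order of «the difference»;
refuted-as-schema ≠ refuted-in-print; Rmk. 1.1.1 lies outside the [IUTchIII] Cor. 3.12 cone; no side taken
on Cor. 3.12; typed ≠ proved for the disputed corpus; nothing here asserts abc proved or refuted.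
-/

namespace Literature.IUT.HodgeArakelov

universe u

variable {S : ThetaSetting.{u}} {M : MonoThetaEnv S} {R : Reconstruction M} {T : ThetaQuotientData R}
  {W : CoreTower R}

/-- **TRANSPORT.** `rigidity_is_difference Sec C` depends on the Def. 1.1 (ii) datum `C` only through its
isomorphism: if `C′` is «the difference of the two sections» and `C.iso = C′.iso`, so is `C`.
[claim: Mochizuki2012, status: disputed] (IUTchII §1 Rmk 1.1.1 (iii), kurims p.23) -/
theorem rigidity_is_difference_of_iso_eq (Sec : TwoSections T W) {C C' : CyclotomicRigidity R}
    (hC' : rigidity_is_difference Sec C') (h : C.iso = C'.iso) :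
    Literature.IUT.HodgeArakelov.rigidity_is_difference Sec C := by
  intro a t s ht hs hta hsa
  obtain ⟨m, hm, hcl⟩ := hC' a t s ht hs hta hsa
  exact ⟨m, by rw [h]; exact hm, hcl⟩

/-- **The solution set of (iii) for a fixed two-sections datum is one isomorphism class**: with
`CyclotomicRigidity.iso_eq_of_rigidity_is_difference` (abc-iut-f-127), two data with the same isomorphism
satisfy the predicate simultaneously. [claim: Mochizuki2012, status: disputed] (IUTchII §1 Rmk 1.1.1 (iii), kurims p.23) -/
theorem rigidity_is_difference_iff_of_iso_eq (Sec : TwoSections T W) {C C' : CyclotomicRigidity R}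
    (h : C.iso = C'.iso) :
    Literature.IUT.HodgeArakelov.rigidity_is_difference Sec C ↔
      Literature.IUT.HodgeArakelov.rigidity_is_difference Sec C' :=
  ⟨fun hC => rigidity_is_difference_of_iso_eq Sec hC h.symm,
    fun hC' => rigidity_is_difference_of_iso_eq Sec hC' h⟩

/-- **CONDITIONAL direct-head form for the INVERSE convention.**  If `C′` is «the difference of the two
sections» and `C.iso` is the pointwise inverse of `C′.iso` in `Π_M` (B8's order `s^alg · (s^Θ)⁻¹` versus the
frozen `s^Θ · (s^alg)⁻¹`), then `C` is ALSO «the difference of the two sections» as soon as `Π_μ(M)` is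
`2`-torsion — the backward half of `rigidity_is_difference_iff_forall_mul_self_eq_one` (abc-iut-f-127); the
closure refuter `not_forall_rigidity_is_difference` is the case `N = 3` where this clause fails.
[claim: Mochizuki2012, status: disputed] (IUTchII §1 Rmk 1.1.1 (iii), kurims p.23) -/
theorem rigidity_is_difference_of_forall_mul_self_eq_one (Sec : TwoSections T W)
    (C C' : CyclotomicRigidity R)
    (hpin : ∀ c, ((C'.iso c : ↥R.extCyc) : M.Pi) = ((C.iso c : ↥R.extCyc) : M.Pi)⁻¹)
    (hC' : rigidity_is_difference Sec C') (h2 : ∀ m : ↥R.extCyc, m * m = 1) :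
    Literature.IUT.HodgeArakelov.rigidity_is_difference Sec C :=
  (rigidity_is_difference_iff_forall_mul_self_eq_one Sec C C' hpin hC').mpr h2

/-- **The same with `C`, `C′` swapped** (inversion of `Π_μ(M)` is an involution): if `C` is «the
difference», `C′.iso = (C.iso)⁻¹` pointwise, and `Π_μ(M)` is `2`-torsion, then `C′` is «the difference» too.
[claim: Mochizuki2012, status: disputed] (IUTchII §1 Rmk 1.1.1 (iii), kurims p.23) -/
theorem rigidity_is_difference_of_inv_of_forall_mul_self_eq_one (Sec : TwoSections T W)
    (C C' : CyclotomicRigidity R)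
    (hpin : ∀ c, ((C'.iso c : ↥R.extCyc) : M.Pi) = ((C.iso c : ↥R.extCyc) : M.Pi)⁻¹)
    (hC : rigidity_is_difference Sec C) (h2 : ∀ m : ↥R.extCyc, m * m = 1) :
    Literature.IUT.HodgeArakelov.rigidity_is_difference Sec C' := by
  refine rigidity_is_difference_of_forall_mul_self_eq_one Sec C' C (fun c => ?_) hC h2
  rw [hpin c, inv_inv]

end Literature.IUT.HodgeArakelov
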